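import Mathlib
import HarnessLib
import Summits.HubbardSuperconductivity.HubbardSuperconductivity.Theorems.KLProgrammeThermalGreenMatsubaraTimeAllU

/-!
# A GENERAL external pair-word of position–time fields against the Hubbard interaction at finite Matsubara cutoff:
# Wick determinant, cluster-sum reduction, termwise `M → ∞` limit, continuity in the external times
# (seat hubbard-kl-k3c4-p2, g3; technique «Matsubara all-U route (R-a), t2 machine»; file 1 of 3)

Route `KLProgramme`, gen-4 child `KLRegimeVolumeLimitV12` (stmt-HubbardSuperconductivity-19858), stub `stub_vl_bound` by the direct
all-`U` route.  After the finite-`M` Schwinger–Dyson form (`…VolumeLimitSchwingerDyson` / `…VolumeLimitOccupation`: `Σ̂⁰_{L,M} = U a_M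
+ U² b_M`, `‖Σ̂ − U²·βL² b_M/D_M‖ ≤ 2|U|` eventually in `M`) clause (i) of the VL text is the SIX-POINT piece `b_M(k,σ)`, a Fourier–Matsubara
coefficient of a COMPOSITE position–time correlation.  Its frequency-uniform control over the moving Matsubara window needs the all-`U`
`M → ∞` limit of such composite correlations with bounds uniform in the external times — i.e. t2's machine (`…TwoPointAssemblyMatsubara*`,
k3c5-p2's `…ThermalGreenMatsubaraTimeAllU` = the case `k = 2`, `m = 1`) for an ARBITRARY external pair-word

  `W_M(s) := ∏_{l<m} ψ⁺_{(y⃗_{Pe l}, s_{Pe l}) (Pe l).2} · ψ⁻_{(y⃗_{Qe l}, s_{Qe l}) (Qe l).2}`,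

`k` external space–time points `(y⃗_p, s_p)`, leg enumerations `Pe, Qe : Fin m → Fin k × Fin 2` (point, spin).  This file is the finite-`M`
and termwise layer:

* §1 bookkeeping — `genPairProd_append`, `append_prodMk_const`, injectivity of the appended leg enumerations (external pairs first,
  then the `2n` vertex pairs; external point `p ↦ natAdd n p`, vertex `a ↦ castAdd k a`), appended times;
* §2 `gaussExpect_word_mul_hubbardInteraction_pow_eq_det` — `∫dμ_{C_M} W_M(s) Vⁿ = Uⁿ Σ_{x⃗} ∫_{[0,β]ⁿ} det[Wick matrix on m+2n legs]`;
* §3 `sum_prod_sum_append_le_general` — the cluster sum over `n+k` points costs `(1+(n+k)K₀)^k (1+kK₀)ⁿ` against the internal one;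
* §4 `tendsto_gaussExpect_word_mul_hubbardInteraction_pow` — the termwise `M → ∞` limit for `s ∈ [0,β)^k` (entries → `vertexLimitEntry`,
  midpoint values at coincident times);
* §5 `continuous_gaussExpect_word` — at fixed `M`, `s ↦ ∫dμ_C W_M(s)·E` is continuous on `ℝ^k` (finite multilinear expansion).

Files 2–3 (`…MatsubaraWordAllU`, `…MatsubaraWordL1`): the all-`U` domination / limit / `s`-uniform bound, and the `L¹(du)` convergence
along a time curve.  Everything is proved; no definition.
-/

namespace Summit.HubbardSuperconductivity.HubbardSuperconductivity.Theorems.MatsubaraAllU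

set_option linter.dupNamespace false -- summit = problem name (single-conjunct summit), D-0017

open MeasureTheory Finset Filter Topology Literature.MathematicalPhysics.QuantumLattice
  Literature.Probability.LatticeModels
open Literature.MathematicalPhysics.QuantumLattice.GrassmannAlgebra
open scoped Nat ComplexOrder

noncomputable section

/-! ### §1 Bookkeeping: appended pair-words, injective enumerations, appended times -/

/-- Paired monomials multiply along `Fin.append`: `∏_{Fin.append} = (∏ first block) · (∏ second block)`. -/
theorem genPairProd_append {R Γ : Type*} [CommRing R] [DecidableEq Γ] {a b : ℕ} (Xb Xu : Fin a → Γ) (Xb' Xu' : Fin b → Γ) :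
    genPairProd R (Fin.append Xb Xb') (Fin.append Xu Xu') = genPairProd R Xb Xu * genPairProd R Xb' Xu' := by
  unfold genPairProd
  rw [← List.prod_append, ← List.ofFn_fin_append]
  congr 1
  refine congrArg List.ofFn (funext fun i => ?_)
  refine Fin.addCases (fun i₁ => ?_) (fun i₂ => ?_) i
  · simp only [Fin.append_left]
  · simp only [Fin.append_right]

/-- Appending two families of legs of the same charge is the charged version of the appended enumeration. -/
theorem append_prodMk_const {α γ : Type*} {a b : ℕ} (f : Fin a → α) (g : Fin b → α) (c : γ) :
    Fin.append (fun i => (f i, c)) (fun j => (g j, c)) = fun i => (Fin.append f g i, c) := by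
  funext i
  induction i using Fin.addCases with
  | left i₁ => simp only [Fin.append_left]
  | right i₂ => simp only [Fin.append_right]

/-- The full barred/unbarred leg enumeration of an external pair-word followed by the `n` vertex words — external pair `l`
at the external point `natAdd n (Pe l).1`, vertex pair `2a+σ` at `castAdd k a` — is injective when `Pe` is. -/
theorem wordEnum_injective {n k m : ℕ} (Pe : Fin m → Fin k × Fin 2) (hPe : Function.Injective Pe) :
    Function.Injective (Fin.append (fun l : Fin m => ((Fin.natAdd n (Pe l).1 : Fin (n + k)), (Pe l).2))
      (fun i : Fin (n * 2) => ((Fin.castAdd k (finProdFinEquiv.symm i : Fin n × Fin 2).1 : Fin (n + k)),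
        (finProdFinEquiv.symm i : Fin n × Fin 2).2))) := by
  intro i j hij
  induction i using Fin.addCases with
  | left i₁ =>
    induction j using Fin.addCases with
    | left j₁ =>
      simp only [Fin.append_left, Prod.mk.injEq] at hij
      have h1 : (Pe i₁).1 = (Pe j₁).1 := Fin.natAdd_injective _ _ hij.1
      rw [hPe (Prod.ext h1 hij.2)]
    | right j₂ =>
      simp only [Fin.append_left, Fin.append_right, Prod.mk.injEq] at hij
      have h := congrArg Fin.val hij.1
      simp only [Fin.val_natAdd, Fin.val_castAdd] at h
      have := (finProdFinEquiv.symm j₂ : Fin n × Fin 2).1.isLt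
      omega
  | right i₂ =>
    induction j using Fin.addCases with
    | left j₁ =>
      simp only [Fin.append_left, Fin.append_right, Prod.mk.injEq] at hij
      have h := congrArg Fin.val hij.1
      simp only [Fin.val_natAdd, Fin.val_castAdd] at h
      have := (finProdFinEquiv.symm i₂ : Fin n × Fin 2).1.isLt
      omega
    | right j₂ =>
      simp only [Fin.append_right, Prod.mk.injEq] at hij
      have h1 : (finProdFinEquiv.symm i₂ : Fin n × Fin 2).1 = (finProdFinEquiv.symm j₂ : Fin n × Fin 2).1 :=
        Fin.castAdd_injective _ _ hij.1
      rw [finProdFinEquiv.symm.injective (Prod.ext h1 hij.2)]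

/-- Appended times: if the vertex times lie in `[0,β]` and the external ones do, all `n + k` times lie in `[0,β]`. -/
theorem append_mem_Icc {n k : ℕ} {β : ℝ} {τ : Fin n → ℝ} (hτ : τ ∈ Set.Icc (0 : Fin n → ℝ) (fun _ => β))
    {se : Fin k → ℝ} (hse : ∀ p, se p ∈ Set.Icc (0 : ℝ) β) (a : Fin (n + k)) :
    (Fin.append τ se : Fin (n + k) → ℝ) a ∈ Set.Icc (0 : ℝ) β := by
  induction a using Fin.addCases with
  | left a₀ => rw [Fin.append_left]; exact ⟨hτ.1 a₀, hτ.2 a₀⟩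
  | right p => rw [Fin.append_right]; exact hse p

/-- Off the faces of the time cube (vertex times in `(0,β)`) and with external times in `[0,β)`, every time difference has
modulus `< β`. -/
theorem abs_append_sub_append_lt_general {n k : ℕ} {β : ℝ} {τ : Fin n → ℝ} (hτ : ∀ a, 0 < τ a ∧ τ a < β)
    {se : Fin k → ℝ} (hse : ∀ p, se p ∈ Set.Ico (0 : ℝ) β) (p q : Fin (n + k)) :
    |(Fin.append τ se : Fin (n + k) → ℝ) q - (Fin.append τ se : Fin (n + k) → ℝ) p| < β := by
  have hall : ∀ r : Fin (n + k), 0 ≤ (Fin.append τ se : Fin (n + k) → ℝ) r ∧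
      (Fin.append τ se : Fin (n + k) → ℝ) r < β := by
    intro r
    induction r using Fin.addCases with
    | left i => rw [Fin.append_left]; exact ⟨(hτ i).1.le, (hτ i).2⟩
    | right j => rw [Fin.append_right]; exact ⟨(hse j).1, (hse j).2⟩
  rw [abs_lt]
  constructor <;> linarith [(hall p).1, (hall p).2, (hall q).1, (hall q).2]

variable {L : ℕ} [NeZero L]

/-- The external pair-word is the image of a paired monomial under the vertex-field substitution of ANY configuration that
extends the external one (`Fin.append x xe`, `Fin.append τ se`). -/
theorem extWord_eq_map_genPairProd {M : ℕ} (β : ℝ) {n k m : ℕ} (x : Fin n → TorusSite 2 L) (τ : Fin n → ℝ)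
    (xe : Fin k → TorusSite 2 L) (se : Fin k → ℝ) (Pe Qe : Fin m → Fin k × Fin 2) :
    (List.ofFn fun l : Fin m => positionField L M β 0 (Pe l).2 (xe (Pe l).1) (se (Pe l).1) *
        positionField L M β 1 (Qe l).2 (xe (Qe l).1) (se (Qe l).1)).prod =
      ExteriorAlgebra.map (Matrix.toLin' (vertexSubMatrix L M β (Fin.append x xe) (Fin.append τ se)))
        (genPairProd ℂ (fun l : Fin m => (((Fin.natAdd n (Pe l).1, (Pe l).2), 0) : VertexLeg (n + k)))
          (fun l : Fin m => (((Fin.natAdd n (Qe l).1, (Qe l).2), 1) : VertexLeg (n + k)))) := by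
  rw [genPairProd, map_list_prod, List.map_ofFn]
  congr 1
  refine congrArg List.ofFn (funext fun l => ?_)
  simp only [Function.comp_apply, map_mul]
  rw [map_vertexSub_gen_eq_positionField, map_vertexSub_gen_eq_positionField, Fin.append_right, Fin.append_right,
    Fin.append_right, Fin.append_right]

/-! ### §2 The order-`n` moment of the word is an integrated Wick determinant -/

/-- **The word moments at finite cutoff are integrated Wick determinants**: for the external pair-word `W_M(s)` above,
`∫dμ_{C_M} W_M(s) Vⁿ = Uⁿ Σ_{x⃗∈Λⁿ} ∫_{[0,β]ⁿ} det[−(S'ᵀC_MS')((P' i,+),(Q' j,−))]_{i,j < m+2n} dτ`, `S'` the substitution of the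
configuration `(x⃗, y⃗ₑ)`, `(τ, s)`, `P', Q'` the appended enumerations (external pairs first). -/
theorem gaussExpect_word_mul_hubbardInteraction_pow_eq_det {M : ℕ} {β : ℝ} (hβ : 0 < β) (μ U : ℝ) {k m : ℕ}
    (xe : Fin k → TorusSite 2 L) (se : Fin k → ℝ) (Pe Qe : Fin m → Fin k × Fin 2) (n : ℕ) :
    gaussExpect ℂ (hubbardCovariance L M β μ 0)
        ((List.ofFn fun l : Fin m => positionField L M β 0 (Pe l).2 (xe (Pe l).1) (se (Pe l).1) *
            positionField L M β 1 (Qe l).2 (xe (Qe l).1) (se (Qe l).1)).prod * hubbardInteraction L M β U ^ n) =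
      (U : ℂ) ^ n * ∑ x : Fin n → TorusSite 2 L, ∫ τ in Set.Icc (0 : Fin n → ℝ) (fun _ => β),
        (Matrix.of fun i j : Fin (m + n * 2) =>
          -((vertexSubMatrix L M β (Fin.append x xe) (Fin.append τ se)).transpose * hubbardCovariance L M β μ 0 *
              vertexSubMatrix L M β (Fin.append x xe) (Fin.append τ se))
            ((Fin.append (fun l : Fin m => ((Fin.natAdd n (Pe l).1 : Fin (n + k)), (Pe l).2))
                (fun i : Fin (n * 2) => ((Fin.castAdd k (finProdFinEquiv.symm i : Fin n × Fin 2).1 : Fin (n + k)),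
                  (finProdFinEquiv.symm i : Fin n × Fin 2).2)) i, 0) : VertexLeg (n + k))
            ((Fin.append (fun l : Fin m => ((Fin.natAdd n (Qe l).1 : Fin (n + k)), (Qe l).2))
                (fun j : Fin (n * 2) => ((Fin.castAdd k (finProdFinEquiv.symm j : Fin n × Fin 2).1 : Fin (n + k)),
                  (finProdFinEquiv.symm j : Fin n × Fin 2).2)) j, 1) : VertexLeg (n + k))).det := by
  set Wd : HubbardGrassmann L M := (List.ofFn fun l : Fin m => positionField L M β 0 (Pe l).2 (xe (Pe l).1) (se (Pe l).1) *
    positionField L M β 1 (Qe l).2 (xe (Qe l).1) (se (Qe l).1)).prod with hWd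
  have key := linearMap_apply_hubbardInteraction_pow (L := L) (M := M) hβ U
    ((gaussExpect ℂ (hubbardCovariance L M β μ 0)).comp (LinearMap.mulLeft ℂ Wd)) n
  simp only [LinearMap.comp_apply, LinearMap.mulLeft_apply] at key
  rw [key]
  refine congrArg _ (sum_congr rfl fun x _ => integral_congr_ae (Eventually.of_forall fun τ => ?_))
  simp only
  set x' : Fin (n + k) → TorusSite 2 L := Fin.append x xe with hx'
  set τ' : Fin (n + k) → ℝ := Fin.append τ se with hτ'
  have hword : (List.ofFn fun a => vertexFieldWord L M β x τ a).prod =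
      (List.ofFn fun a => vertexFieldWord L M β x' τ' (Fin.castAdd k a)).prod := by
    congr 1
    refine congrArg List.ofFn (funext fun a => vertexFieldWord_congr β ?_ ?_)
    · rw [hx', Fin.append_left]
    · rw [hτ', Fin.append_left]
  rw [hword, prod_vertexFieldWord_comp_eq_map_genPairProd, hWd, extWord_eq_map_genPairProd β x τ xe se Pe Qe,
    ← map_mul, ← genPairProd_append, append_prodMk_const, append_prodMk_const, hx', hτ',
    gaussExpect_vertexWord_eq_det β μ (Fin.append x xe) (Fin.append τ se)]

/-! ### §3 The cluster sum over `n + k` points against the internal one -/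

/-- **Reduction of the cluster sum over `n + k` points to the internal one, for ARBITRARY external times** (t2's
`sum_prod_sum_append_le` / k3c5-p2's `…_time` are `k = 2`; only `0 ≤ w ≤ K₀` is used):
`Σ_{T⊆[n+k]} ∏_{a∈T} Σ_{b∈[n+k]} w(τ'_b − τ'_a) ≤ (1+(n+k)K₀)^k (1+kK₀)ⁿ Σ_{T⊆[n]} ∏_{a∈T} Σ_{b∈[n]} w(τ_b − τ_a)`, `τ' = (τ, s)`. -/
theorem sum_prod_sum_append_le_general {n k : ℕ} (wr : ℝ → ℝ) (hw0 : ∀ u, 0 ≤ wr u) (K₀ : ℝ) (hK : ∀ u, wr u ≤ K₀)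
    (τ : Fin n → ℝ) (e : Fin k → ℝ) :
    ∑ T : Finset (Fin (n + k)), ∏ a ∈ T, ∑ b : Fin (n + k),
        wr ((Fin.append τ e : Fin (n + k) → ℝ) b - (Fin.append τ e : Fin (n + k) → ℝ) a) ≤
      (1 + (n + k : ℝ) * K₀) ^ k * (1 + k * K₀) ^ n *
        ∑ T : Finset (Fin n), ∏ a ∈ T, ∑ b : Fin n, wr (τ b - τ a) := by
  classical
  have hK0 : 0 ≤ K₀ := (hw0 0).trans (hK 0)
  set τ' : Fin (n + k) → ℝ := Fin.append τ e with hτ'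
  set g' : Fin (n + k) → ℝ := fun a => ∑ b : Fin (n + k), wr (τ' b - τ' a) with hg'
  set g : Fin n → ℝ := fun a => ∑ b : Fin n, wr (τ b - τ a) with hg
  have hg0 : ∀ a, 0 ≤ g a := fun a => Finset.sum_nonneg fun b _ => hw0 _
  have hg'0 : ∀ a, 0 ≤ g' a := fun a => Finset.sum_nonneg fun b _ => hw0 _
  have hleft : ∀ a₀ : Fin n, τ' (Fin.castAdd k a₀) = τ a₀ := fun a₀ => by simp [hτ']
  -- internal points: `g'(castAdd a₀) ≤ g(a₀) + kK₀`
  have hint : ∀ a₀ : Fin n, g' (Fin.castAdd k a₀) ≤ g a₀ + k * K₀ := by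
    intro a₀
    simp only [hg', Fin.sum_univ_add, hleft]
    refine add_le_add le_rfl ?_
    calc ∑ j : Fin k, wr (τ' (Fin.natAdd n j) - τ a₀) ≤ ∑ _j : Fin k, K₀ := Finset.sum_le_sum fun j _ => hK _
      _ = k * K₀ := by simp
  -- external points: `g'(natAdd j) ≤ (n+k)K₀`
  have hext : ∀ j : Fin k, g' (Fin.natAdd n j) ≤ (n + k : ℝ) * K₀ := by
    intro j
    calc g' (Fin.natAdd n j) ≤ ∑ _b : Fin (n + k), K₀ := Finset.sum_le_sum fun b _ => hK _
      _ = (n + k : ℝ) * K₀ := by simp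
  rw [sum_univ_prod_eq_prod_one_add, sum_univ_prod_eq_prod_one_add, Fin.prod_univ_add]
  have h1 : ∏ a₀ : Fin n, (1 + g' (Fin.castAdd k a₀)) ≤ (1 + k * K₀) ^ n * ∏ a₀ : Fin n, (1 + g a₀) := by
    calc ∏ a₀ : Fin n, (1 + g' (Fin.castAdd k a₀)) ≤ ∏ a₀ : Fin n, ((1 + k * K₀) * (1 + g a₀)) :=
          Finset.prod_le_prod (fun a₀ _ => by linarith [hg'0 (Fin.castAdd k a₀)]) fun a₀ _ => by
            have hkg : 0 ≤ (k : ℝ) * K₀ * g a₀ := mul_nonneg (mul_nonneg (Nat.cast_nonneg k) hK0) (hg0 a₀)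
            nlinarith [hint a₀, hg0 a₀, hK0, hkg]
      _ = (1 + k * K₀) ^ n * ∏ a₀ : Fin n, (1 + g a₀) := by
          rw [Finset.prod_mul_distrib, Finset.prod_const, Finset.card_univ, Fintype.card_fin]
  have h2 : ∏ j : Fin k, (1 + g' (Fin.natAdd n j)) ≤ (1 + (n + k : ℝ) * K₀) ^ k := by
    calc ∏ j : Fin k, (1 + g' (Fin.natAdd n j)) ≤ ∏ _j : Fin k, (1 + (n + k : ℝ) * K₀) :=
          Finset.prod_le_prod (fun j _ => by linarith [hg'0 (Fin.natAdd n j)]) fun j _ => by linarith [hext j]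
      _ = (1 + (n + k : ℝ) * K₀) ^ k := by
          rw [Finset.prod_const, Finset.card_univ, Fintype.card_fin]
  calc (∏ a₀ : Fin n, (1 + g' (Fin.castAdd k a₀))) * ∏ j : Fin k, (1 + g' (Fin.natAdd n j))
      ≤ ((1 + k * K₀) ^ n * ∏ a₀ : Fin n, (1 + g a₀)) * (1 + (n + k : ℝ) * K₀) ^ k :=
        mul_le_mul h1 h2 (Finset.prod_nonneg fun j _ => by linarith [hg'0 (Fin.natAdd n j)])
          (mul_nonneg (pow_nonneg (by positivity) _) (Finset.prod_nonneg fun a₀ _ => by linarith [hg0 a₀]))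
    _ = (1 + (n + k : ℝ) * K₀) ^ k * (1 + k * K₀) ^ n * ∏ a₀ : Fin n, (1 + g a₀) := by ring

/-! ### §4 The termwise `M → ∞` limit of the word moments -/

/-- **The `M → ∞` limit of the word moments** (k3c5-p2's / the tree's `tendsto_gaussExpect_twoPoint_mul_hubbardInteraction_pow`
for a general word): for `β > 0`, external times `s ∈ [0,β)^k` and fixed `(L, μ, U, n)`, the `n`-th moment of the word converges
to `Uⁿ Σ_{x⃗} ∫_{[0,β]ⁿ} det[vertexLimitEntry(x'_{P' i}, x'_{Q' j}, σ_i, σ_j; τ'_{Q' j} − τ'_{P' i})] dτ` (midpoint values at equal times: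
the faces of the cube are null and all time differences are `< β` in modulus). -/
theorem tendsto_gaussExpect_word_mul_hubbardInteraction_pow {β : ℝ} (hβ : 0 < β) (μ U : ℝ) {k m : ℕ}
    (xe : Fin k → TorusSite 2 L) {se : Fin k → ℝ} (hse : ∀ p, se p ∈ Set.Ico (0 : ℝ) β)
    (Pe Qe : Fin m → Fin k × Fin 2) (n : ℕ) :
    Tendsto (fun M : ℕ => gaussExpect ℂ (hubbardCovariance L M β μ 0)
        ((List.ofFn fun l : Fin m => positionField L M β 0 (Pe l).2 (xe (Pe l).1) (se (Pe l).1) *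
            positionField L M β 1 (Qe l).2 (xe (Qe l).1) (se (Qe l).1)).prod * hubbardInteraction L M β U ^ n)) atTop
      (𝓝 ((U : ℂ) ^ n * ∑ x : Fin n → TorusSite 2 L, ∫ τ in Set.Icc (0 : Fin n → ℝ) (fun _ => β),
        (Matrix.of fun i j : Fin (m + n * 2) =>
          vertexLimitEntry L β μ
            ((Fin.append x xe : Fin (n + k) → TorusSite 2 L)
              (Fin.append (fun l : Fin m => ((Fin.natAdd n (Pe l).1 : Fin (n + k)), (Pe l).2))
                (fun i : Fin (n * 2) => ((Fin.castAdd k (finProdFinEquiv.symm i : Fin n × Fin 2).1 : Fin (n + k)),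
                  (finProdFinEquiv.symm i : Fin n × Fin 2).2)) i).1)
            ((Fin.append x xe : Fin (n + k) → TorusSite 2 L)
              (Fin.append (fun l : Fin m => ((Fin.natAdd n (Qe l).1 : Fin (n + k)), (Qe l).2))
                (fun j : Fin (n * 2) => ((Fin.castAdd k (finProdFinEquiv.symm j : Fin n × Fin 2).1 : Fin (n + k)),
                  (finProdFinEquiv.symm j : Fin n × Fin 2).2)) j).1)
            (Fin.append (fun l : Fin m => ((Fin.natAdd n (Pe l).1 : Fin (n + k)), (Pe l).2))
              (fun i : Fin (n * 2) => ((Fin.castAdd k (finProdFinEquiv.symm i : Fin n × Fin 2).1 : Fin (n + k)),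
                (finProdFinEquiv.symm i : Fin n × Fin 2).2)) i).2
            (Fin.append (fun l : Fin m => ((Fin.natAdd n (Qe l).1 : Fin (n + k)), (Qe l).2))
              (fun j : Fin (n * 2) => ((Fin.castAdd k (finProdFinEquiv.symm j : Fin n × Fin 2).1 : Fin (n + k)),
                (finProdFinEquiv.symm j : Fin n × Fin 2).2)) j).2
            ((Fin.append τ se : Fin (n + k) → ℝ)
                (Fin.append (fun l : Fin m => ((Fin.natAdd n (Qe l).1 : Fin (n + k)), (Qe l).2))
                  (fun j : Fin (n * 2) => ((Fin.castAdd k (finProdFinEquiv.symm j : Fin n × Fin 2).1 : Fin (n + k)),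
                    (finProdFinEquiv.symm j : Fin n × Fin 2).2)) j).1 -
              (Fin.append τ se : Fin (n + k) → ℝ)
                (Fin.append (fun l : Fin m => ((Fin.natAdd n (Pe l).1 : Fin (n + k)), (Pe l).2))
                  (fun i : Fin (n * 2) => ((Fin.castAdd k (finProdFinEquiv.symm i : Fin n × Fin 2).1 : Fin (n + k)),
                    (finProdFinEquiv.symm i : Fin n × Fin 2).2)) i).1)).det)) := by
  simp_rw [gaussExpect_word_mul_hubbardInteraction_pow_eq_det hβ]
  set P' : Fin (m + n * 2) → Fin (n + k) × Fin 2 := Fin.append (fun l : Fin m => ((Fin.natAdd n (Pe l).1 : Fin (n + k)), (Pe l).2))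
    (fun i : Fin (n * 2) => ((Fin.castAdd k (finProdFinEquiv.symm i : Fin n × Fin 2).1 : Fin (n + k)),
      (finProdFinEquiv.symm i : Fin n × Fin 2).2)) with hP'
  set Q' : Fin (m + n * 2) → Fin (n + k) × Fin 2 := Fin.append (fun l : Fin m => ((Fin.natAdd n (Qe l).1 : Fin (n + k)), (Qe l).2))
    (fun j : Fin (n * 2) => ((Fin.castAdd k (finProdFinEquiv.symm j : Fin n × Fin 2).1 : Fin (n + k)),
      (finProdFinEquiv.symm j : Fin n × Fin 2).2)) with hQ'
  refine (tendsto_finsetSum _ fun x _ => ?_).const_mul _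
  refine Literature.Analysis.Matrix.tendsto_setIntegral_det (Literature.Analysis.Matrix.volume_Icc_cube_ne_top β)
    measurableSet_Icc (volume_setOf_exists_apply_mem_pair β) (fun M i j => ?_)
    (B := (1 / (L : ℝ) ^ 2) * ∑ q : TorusSite 2 L, (2 + β * |nambuXi L μ q| / 3)) (fun M τ _ i j => ?_)
    fun τ hτ hτS i j => ?_
  · simp only [Matrix.of_apply]
    exact (continuous_vertexWickEntry hβ.ne' μ (Fin.append x xe) M (P' i).1 (Q' j).1 (P' i).2 (Q' j).2).comp
      (continuous_append_const se)
  · simp only [Matrix.of_apply]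
    exact norm_vertexWickEntry_le hβ μ (Fin.append x xe) _ M (P' i).1 (Q' j).1 (P' i).2 (Q' j).2
  · simp only [Matrix.of_apply]
    have hint : ∀ c, 0 < τ c ∧ τ c < β := by
      intro c
      refine ⟨lt_of_le_of_ne (hτ.1 c) fun h => hτS ⟨c, Or.inl h.symm⟩,
        lt_of_le_of_ne (hτ.2 c) fun h => hτS ⟨c, Or.inr h⟩⟩
    exact tendsto_vertexWickEntry hβ μ (Fin.append x xe) (Fin.append τ se) (P' i).1 (Q' j).1 (P' i).2 (Q' j).2
      (abs_append_sub_append_lt_general hint hse _ _)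

/-! ### §5 Continuity of the word expectation in the external times -/

omit [NeZero L] in
/-- The coefficient of `ψ̂^c_{kσ}` in the position–time field `ψ^c_{(y⃗,s)σ}` is a continuous function of the time `s`. -/
theorem continuous_positionField_coeff (M : ℕ) (β : ℝ) (c : Fin 2) (kk : FreqMomentum L M) (y : TorusSite 2 L) :
    Continuous fun s : ℝ => (((1 / (β * (L : ℝ) ^ 2) : ℝ) : ℂ)) * (starRingEnd ℂ) (vertexPlaneWave L M β c kk y s) := by
  refine continuous_const.mul (Complex.continuous_conj.comp ?_)
  unfold vertexPlaneWave vertexPhase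
  refine Complex.continuous_exp.comp ((Continuous.neg ?_).mul continuous_const)
  exact Complex.continuous_ofReal.comp (continuous_const.mul ((continuous_const.mul continuous_id).add continuous_const))

/-- **Continuity of the word expectation in the external times** (finite cutoff `M`, any fixed right factor `E` and any
covariance `C`): `s ↦ ∫dμ_C W_M(s)·E` is continuous on `ℝ^k` (the word is a finite multilinear combination of fixed Grassmann
monomials with coefficients that are exponentials of the times). -/
theorem continuous_gaussExpect_word {M : ℕ} (β : ℝ) {k m : ℕ} (xe : Fin k → TorusSite 2 L) (Pe Qe : Fin m → Fin k × Fin 2)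
    (C : Matrix (HubbardFieldIdx L M) (HubbardFieldIdx L M) ℂ) (E : HubbardGrassmann L M) :
    Continuous fun se : Fin k → ℝ => gaussExpect ℂ C
      ((List.ofFn fun l : Fin m => positionField L M β 0 (Pe l).2 (xe (Pe l).1) (se (Pe l).1) *
          positionField L M β 1 (Qe l).2 (xe (Qe l).1) (se (Qe l).1)).prod * E) := by
  classical
  -- the `2m` factors of the word, leg `i ↦ (pair, charge)`
  set lg : Fin (m * 2) → Fin k × Fin 2 := fun i =>
    (![Pe (finProdFinEquiv.symm i : Fin m × Fin 2).1, Qe (finProdFinEquiv.symm i : Fin m × Fin 2).1] :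
      Fin 2 → Fin k × Fin 2) (finProdFinEquiv.symm i : Fin m × Fin 2).2 with hlg
  set cf : Fin (m * 2) → FreqMomentum L M → (Fin k → ℝ) → ℂ := fun i kk se =>
    (((1 / (β * (L : ℝ) ^ 2) : ℝ) : ℂ)) *
      (starRingEnd ℂ) (vertexPlaneWave L M β (finProdFinEquiv.symm i : Fin m × Fin 2).2 kk (xe (lg i).1) (se (lg i).1)) with hcf
  set gn : Fin (m * 2) → FreqMomentum L M → HubbardGrassmann L M := fun i kk =>
    gen ℂ (((kk, (lg i).2), (finProdFinEquiv.symm i : Fin m × Fin 2).2) : HubbardFieldIdx L M) with hgn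
  have hword : ∀ se : Fin k → ℝ,
      (List.ofFn fun l : Fin m => positionField L M β 0 (Pe l).2 (xe (Pe l).1) (se (Pe l).1) *
          positionField L M β 1 (Qe l).2 (xe (Qe l).1) (se (Qe l).1)).prod =
        (List.ofFn fun i : Fin (m * 2) => ∑ kk : FreqMomentum L M, cf i kk se • gn i kk).prod := by
    intro se
    rw [prod_ofFn_mul_two m]
    congr 1
    refine congrArg List.ofFn (funext fun l => ?_)
    simp only [hcf, hgn, hlg, Equiv.symm_apply_apply, positionField, Matrix.cons_val_zero, Matrix.cons_val_one]
  have hexp : ∀ se : Fin k → ℝ, gaussExpect ℂ C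
      ((List.ofFn fun l : Fin m => positionField L M β 0 (Pe l).2 (xe (Pe l).1) (se (Pe l).1) *
          positionField L M β 1 (Qe l).2 (xe (Qe l).1) (se (Qe l).1)).prod * E) =
      ∑ K : Fin (m * 2) → FreqMomentum L M, (∏ i, cf i (K i) se) *
        gaussExpect ℂ C ((List.ofFn fun i : Fin (m * 2) => gn i (K i)).prod * E) := by
    intro se
    rw [hword se, prod_ofFn_sum_smul, Finset.sum_mul, map_sum]
    refine Finset.sum_congr rfl fun K _ => ?_
    rw [smul_mul_assoc, map_smul, smul_eq_mul]
  simp_rw [hexp]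
  refine continuous_finsetSum _ fun K _ => (continuous_finsetProd _ fun i _ => ?_).mul continuous_const
  simp only [hcf]
  exact (continuous_positionField_coeff (L := L) M β _ (K i) (xe (lg i).1)).comp (continuous_apply _)

end

end Summit.HubbardSuperconductivity.HubbardSuperconductivity.Theorems.MatsubaraAllU
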